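import Literature.Computability.QuantumComplexity.GRStagePlaced
import Literature.Computability.QuantumComplexity.QFTStagePlaced
import Literature.Computability.QuantumComplexity.GadgetizeList
import HarnessLib

/-!
# The Grover–Rudolph stage and the Fourier stage of Regev's sampler are oracle-free circuits

Topic `Literature/Computability/QuantumComplexity`; bookkeeping sequel of `GRStagePlaced.lean`
(`GRStage.stageCircuit D E`: the Grover–Rudolph block `blockCircuit D` — per level the conjugated clean
compute block around the gadget word `grWord` — transported onto every block zone `E i`) and
`QFTStagePlaced.lean` (`QFTStage.stageCircuit E hk1`: the approximate-QFT block `QFTWord.blockCircuit` —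
phase words `qftPhaseWord`, Hadamards `hadWord` — transported onto every register). In Regev's reduction
(J. ACM 56 (2009), art. 34, Lemma 3.14 with Lemma 3.3) the sampler must be an ordinary (oracle-free,
uniform) circuit family; this file records that no stage of the machine contains an oracle gate — every
piece is compiled from Clifford+T letters (`revCompile_isOracleFree`, `sandwichCircuit_isOracleFree`,
`phaseSandwichCircuit_isOracleFree`, `reflectCircuit_isOracleFree`, `oaaWordCircuit_isOracleFree`):

* `isOracleFree_chainCircuit`; `GRWord.grWord_isOracleFree`, `GRStage.levelCircuit_isOracleFree` (the clean compute
  blocks by `revCompile_isOracleFree`), `GRStage.blockCircuit_isOracleFree`,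
  **`GRStage.stageCircuit_isOracleFree`**;
* `QFTWord.qftPhaseWord_isOracleFree`, `QFTWord.pairWord_isOracleFree`, `QFTWord.hadWord_isOracleFree`,
  `QFTWord.blockCircuit_isOracleFree`, `QFTStage.block_isOracleFree`, **`QFTStage.stageCircuit_isOracleFree`**.

Everything is proved; no definition, no named fact is introduced.

## References

* O. Regev, *On lattices, learning with errors, random linear codes, and cryptography*, J. ACM 56
  (2009), art. 34; arXiv:2401.03703: Lemma 3.14 (proof), Lemma 3.3 (proof) [Regev2009].
* M. A. Nielsen, I. L. Chuang, *Quantum Computation and Quantum Information*, CUP 2010, §4.5 (circuit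
  families over a fixed gate set) [NielsenChuang2010].
-/

noncomputable section

namespace Literature.Computability.QuantumComplexity

open Cryptography

variable {N : ℕ}

/-- A chain of oracle-free circuits is oracle-free. [folklore] -/
theorem isOracleFree_chainCircuit : ∀ {L : List (QCircuit cliffordT N)}, (∀ C ∈ L, C.IsOracleFree) →
    (chainCircuit L).IsOracleFree
  | [], _ => fun _ hg => by simp [chainCircuit] at hg
  | C :: Cs, h => fun g hg => by
    simp only [chainCircuit, QCircuit.append, List.mem_append] at hg
    rcases hg with hg | hg
    · exact isOracleFree_chainCircuit (fun D hD => h D (List.mem_cons_of_mem _ hD)) g hg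
    · exact h C (List.mem_cons_self ..) g hg

/-! ### The Grover–Rudolph stage -/

namespace GRWord

/-- **The level gadget word is oracle-free.** [folklore] -/
theorem grWord_isOracleFree {kit : GadgetKit N} (hk : kit.OK) {t : Fin N} {fs : Fin kit.k ↪ Fin N} (hW : WiresOK kit t fs)
    (hP : ProgOK kit) : (grWord hk hW hP).IsOracleFree := by
  unfold grWord
  refine oaaWordCircuit_isOracleFree ?_ ?_
  · apply sandwichCircuit_isOracleFree
  · apply reflectCircuit_isOracleFree

end GRWord

namespace GRStage

variable {B ℓ np : ℕ} {kit : GadgetKit B} {ws : Fin ℓ ↪ Fin B} {pw : Fin np ↪ Fin B} {a : Fin ℓ → (Fin ℓ → Bool) → ℝ}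
  (D : GRBlock.Data kit ws pw a)

/-- Every level circuit is oracle-free. [folklore] -/
theorem levelCircuit_isOracleFree (j : Fin ℓ) : (levelCircuit D j).IsOracleFree := by
  refine isOracleFree_chainCircuit fun C hC => ?_
  simp only [List.mem_cons, List.not_mem_nil, or_false] at hC
  rcases hC with rfl | rfl | rfl
  · exact revCompile_isOracleFree _
  · exact GRWord.grWord_isOracleFree _ _ _
  · exact revCompile_isOracleFree _

/-- **The Grover–Rudolph block is oracle-free.** [folklore] -/
theorem blockCircuit_isOracleFree : (blockCircuit D).IsOracleFree := by
  refine isOracleFree_chainCircuit fun C hC => ?_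
  rw [List.mem_reverse, List.mem_ofFn] at hC
  obtain ⟨j, rfl⟩ := hC
  exact levelCircuit_isOracleFree D j

/-- **The Grover–Rudolph stage is oracle-free.** [cite: Regev2009, Lemma 3.14 (proof)] -/
theorem stageCircuit_isOracleFree {n W : ℕ} (E : Fin n → (Fin B ↪ Fin W)) : (stageCircuit D E).IsOracleFree := by
  intro g hg
  simp only [stageCircuit, List.mem_flatMap, List.mem_finRange, true_and] at hg
  obtain ⟨i, hg⟩ := hg
  exact StabilizerFormalism.isOracleFree_map_mapWiresGate (E i) (blockCircuit_isOracleFree D) g hg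

end GRStage

/-! ### The Fourier stage -/

namespace QFTWord

variable {κ : ℕ}

/-- The phase word of a pair is oracle-free. [folklore] -/
theorem qftPhaseWord_isOracleFree {kit : GadgetKit N} (hk : kit.OK) {ws : Fin κ ↪ Fin N} (hW : WiresOK kit ws)
    (j l : Fin κ) (hjl : j < l) (hP : ProgOK kit j l) :
    (qftPhaseWord hk hW j l hjl hP).IsOracleFree := by
  unfold qftPhaseWord
  refine oaaWordCircuit_isOracleFree ?_ ?_
  · apply phaseSandwichCircuit_isOracleFree
  · apply reflectCircuit_isOracleFree

/-- The word of a pair is oracle-free. [folklore] -/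
theorem pairWord_isOracleFree {kit : GadgetKit N} (hk : kit.OK) {ws : Fin κ ↪ Fin N} (hW : WiresOK kit ws)
    (hP : ∀ j l : Fin κ, j < l → ProgOK kit j l) (j l : Fin κ) :
    (pairWord hk hW hP j l).IsOracleFree := by
  unfold pairWord
  split_ifs with h
  · exact qftPhaseWord_isOracleFree hk hW j l h (hP j l h)
  · intro g hg; simp at hg

/-- The Hadamard word is oracle-free. [folklore] -/
theorem hadWord_isOracleFree (ws : Fin κ ↪ Fin N) (j : Fin κ) : (hadWord ws j).IsOracleFree := by
  intro g hg
  simp only [hadWord, List.mem_singleton] at hg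
  subst hg
  trivial

/-- **The approximate-QFT block is oracle-free.** [folklore] -/
theorem blockCircuit_isOracleFree {kit : GadgetKit N} (hk : kit.OK) {ws : Fin κ ↪ Fin N} (hW : WiresOK kit ws)
    (hP : ∀ j l : Fin κ, j < l → ProgOK kit j l) : (blockCircuit hk hW hP).IsOracleFree := by
  refine isOracleFree_chainCircuit fun C hC => ?_
  simp only [blockWords, List.mem_flatten, List.mem_reverse, List.mem_ofFn] at hC
  obtain ⟨R, ⟨j, rfl⟩, hC⟩ := hC
  simp only [roundWords, List.mem_append, List.mem_ofFn, List.mem_singleton] at hC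
  rcases hC with ⟨l, rfl⟩ | rfl
  · exact pairWord_isOracleFree hk hW hP j l
  · exact hadWord_isOracleFree ws j

end QFTWord

namespace QFTStage

variable {κ n k W : ℕ} (E : Fin n → (Fin (QFTKit.qbsize κ k) ↪ Fin W)) (hk1 : 1 ≤ k)

/-- The Fourier block of the stage is oracle-free. [folklore] -/
theorem block_isOracleFree : (block (κ := κ) hk1).IsOracleFree := QFTWord.blockCircuit_isOracleFree _ _ _

/-- **The Fourier stage is oracle-free.** [cite: Regev2009, Lemma 3.14 (proof)] -/
theorem stageCircuit_isOracleFree : (stageCircuit E hk1).IsOracleFree := by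
  refine isOracleFree_chainCircuit fun C hC => ?_
  rw [List.mem_reverse, List.mem_ofFn] at hC
  obtain ⟨i, rfl⟩ := hC
  exact StabilizerFormalism.isOracleFree_map_mapWiresGate (E i) (block_isOracleFree (κ := κ) hk1)

end QFTStage

end Literature.Computability.QuantumComplexity

end
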